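import Summits.HodgeConjecture.HodgeConjecture.Theorems.F0P3ArchIsotypyConj        -- ★ p803493 (this seat): `archIsotypy_cm_of_hol_half` — F1a descends from `P̄` to `P`
import Summits.HodgeConjecture.HodgeConjecture.Theorems.F0P3StubF1aHolHalf        -- ★ (F0P3-p02 (g3), p805224): `holHalfF1aCM_cpt` — the holomorphic half at the CM pin
import HarnessLib

/-!
# Crux `H413`, rung-1 line `F0_U3LettersRung1` — the BY-NAME CLOSER of `stub_F1a_cm` (CONTRACT v5): letter F1a
# `DiscreteAutomorphicRep.ArchIsotypy` at the CM frame for every H¹-cohomological discrete `P`, PROVED IN-HOUSE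

Cell hodgecm-mathlib, FLOOR 0; crux item H413 = stmt-HodgeConjecture-24833; line `Cruxes/H413/Lines/F0_U3LettersRung1.lean` ed. 2.4 (commit
aa21cf375713), stub `stub_F1a_cm : StubF1aCM` with the CONTRACT-v5 text (`hdef`, `h2` after `hT`; tree :116ff).  PROOF lane, no `def`;
author F0P3-p01 (g4).  Pure composition of ★ tree theorems — the road «isotypy from a null core» (F0P3-p02 (g3): B1 ★
`F0P3GenIrreducibleOfUnitary`, B2 ★ `HarishChandraModuleIntertwiners`, B3 ★ `F0P3LieSpanClosureInvariant` ∕ `F0P3HolFormClosedSubrep`, B4 ★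
`F0P3GenClosureKFinite` ∕ `F0P3HolFormGenClasses`, B5a ★ `F0P3TranslateDetection`, B5b ★ `F0P3ArchIsotypyOfIrreducibleCore` ∕ `F0P3ClosedSubrepGKModule`,
B5c ★ `F0P3HolFormArchIsotypy`, (a) ★ `F0P3HolFormKType` (F0P3-p03 (g4)), (b) ★ `F0P3GenAdmissible` ∕ `F0P3HolFormAdmissible` (F0P3-p03 (g4)),
closer ★ `F0P3StubF1aHolHalf.holHalfF1aCM_cpt`) gives the HOLOMORPHIC half; the ANTIHOLOMORPHIC half is the holomorphic one for `P̄` transported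
along complex conjugation (★ `F0P3GKModuleConjVec`, ★ `F0P3ArchIsotypyConj.archIsotypy_cm_of_hol_half`).  Line fold (ed. 2.5):
`stub_F1a_cm := F0P3StubF1aCM.stubF1aCM_holds`.  HONEST LABEL: HC_CM is proved only modulo the printed citations until rung 0 closes — after
this fold the letter ledger of row III-J3a is {E1_coh, β} (Rogawski, Ch. 13–14) ∪ {F1b}.

References: [FlathCorvallis1979] Thm. 3–4; [BorelJacquetCorvallis1979] §4.3, §4.6; [Dixmier1977] §13.1.8; [BorelWallach2000] 0 §2.4–2.5, VII 2.10;
[Clozel1990] §3.1 — the printed tensor-product∕type-I statement that this in-house route REPLACES for the consumed instances.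
-/

set_option autoImplicit false
-- the mandated namespace repeats `HodgeConjecture.HodgeConjecture`, as in every `Theorems/*.lean` of this sub-problem
set_option linter.dupNamespace false

open MeasureTheory NumberField
open scoped Matrix ComplexOrder

namespace Summit.HodgeConjecture.HodgeConjecture.Cruxes.H413.F0P3StubF1aCM

open Literature.NumberTheory.Automorphic Literature.NumberTheory.Automorphic.UnitaryGroup
open Literature.NumberTheory.Automorphic.UnitaryGroup.CotangentForms (cmArchSection cmCompactFactor)
open Literature.RepresentationTheory.KonnoKonno2007 (uFormGroup)

/-- **`stub_F1a_cm` CLOSER (CONTRACT v5): letter F1a at the CM frame for every discrete automorphic `P` of `U(H)` of Hodge type `(1,0)` OR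
`(0,1)` at `ι`, `H` definite away from `ι`, `[L⁺:ℚ] ≥ 2`** — statement = the text of `StubF1aCM` in `Lines/F0_U3LettersRung1.lean` ed. 2.4
VERBATIM; proof = ★ `archIsotypy_cm_of_hol_half` (conjugation transport) over ★ `holHalfF1aCM_cpt` (the holomorphic half).
[cite: FlathCorvallis1979, Thm. 3 and Thm. 4] [cite: BorelJacquetCorvallis1979, §4.3 and §4.6] [cite: Dixmier1977, §13.1.8]
[cite: BorelWallach2000, VII 2.10] [cite: Clozel1990, §3.1] -/
theorem stubF1aCM_holds :
    ∀ (L : Type) [Field L] [NumberField L] [IsCMField L] (ι : L →+* ℂ) (H : Matrix (Fin 3) (Fin 3) L) (T : GL (Fin 3) ℂ)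
      (hT : (T : Matrix (Fin 3) (Fin 3) ℂ)ᴴ * H.map ι * (T : Matrix (Fin 3) (Fin 3) ℂ) = Literature.Geometry.ComplexHyperbolic.BallModel.J),
      (∀ τ' : L →+* ℂ, InfinitePlace.mk τ' ≠ InfinitePlace.mk ι → (H.map τ').PosDef) →
      2 ≤ Module.finrank ℚ ↥(maximalRealSubfield L) →
      ∀ (μ : Measure (adelicGroupData (↥(maximalRealSubfield L)) L (IsCMField.complexConj L) 3 H).automorphicQuotient)
      [(adelicGroupData (↥(maximalRealSubfield L)) L (IsCMField.complexConj L) 3 H).IsAutomorphicMeasure μ]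
      (P : DiscreteAutomorphicRep (adelicGroupData (↥(maximalRealSubfield L)) L (IsCMField.complexConj L) 3 H) μ),
      (P.IsHolCotangentAt (cmArchSection L ι H T hT) (cmCompactFactor L ι H T hT) ∨
        P.IsAntiholCotangentAt (cmArchSection L ι H T hT) (cmCompactFactor L ι H T hT)) →
      P.ArchIsotypy (uFormGroup (Fin 2) (Fin 1)) (cmArchSectionUForm L ι H T hT) :=
  fun L _ _ _ ι H T hT hdef h2 μ _ P hP =>
    F0P3ArchIsotypyConj.archIsotypy_cm_of_hol_half L ι H T hT μ
      (fun P' hP' => F0P3StubF1aHolHalf.holHalfF1aCM_cpt L ι H T hT hdef h2 μ P' hP') P hP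

end Summit.HodgeConjecture.HodgeConjecture.Cruxes.H413.F0P3StubF1aCM
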